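import Mathlib
import Literature.MathematicalPhysics.StatisticalMechanics.OneCrossingMixture

/-!
# Crux `ExactCertificate` (stmt-AtomisticToContinuum-11959), line `closure-makes-nogap-exact`,
# Transfer1D skeleton (`ExactCertificate1D`): stub `stub_psiPosTypeOf`

The retarded Green's function `Ψ_a(y) := -4 Σ_{k ≥ 0} (k+1) · V(|y| + (k+1)a)` (`V = lennardJones`)
is of positive type on `ℝ`: for every `a > 0` at zero pressure
(`Σ_k (k+1)[((k+1)a)⁻⁷ - ((k+1)a)⁻¹³] = 0`) and every finite family of points `x_i ∈ ℝ` and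
weights `w_i ∈ ℝ`, `0 ≤ Σ_{ij} w_i w_j Ψ_a(x_i - x_j)`.

The proof is the Laplace representation `-V(r) = ∫_0^∞ e^{-tr} p(t) dt`,
`p(t) = t⁵/720 - t¹¹/479001600` (Euler's integral), which rewrites the Gram form as
`4 Σ_k (k+1) ∫_0^∞ e^{-t(k+1)a} p(t) Q(t) dt` with `Q(t) = Σ_{ij} w_i w_j e^{-t|x_i - x_j|}`, followed
by the two hypotheses of the statement (the registered statements of the neighbouring stubs
`stub_quadAntitone` — `t ↦ Q(t)/t` is antitone on `(0,∞)` — and `stub_crossing` — the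
single-crossing lemma applied with `h = Q/t`).
-/

noncomputable section

namespace Summit.AtomisticToContinuum.Crystallization.Theorems.ThreeConeCertificateExactCertificate.Transfer1D

open Literature.MathematicalPhysics.StatisticalMechanics MeasureTheory Set
open scoped BigOperators

/-- The Laplace integrand `e^{-tr} p(t)`, `p(t) = t⁵/720 - t¹¹/479001600`, is integrable on `(0,∞)`
for `r > 0`. -/
private theorem psiPos_integrableOn_laplace {r : ℝ} (hr : 0 < r) :
    IntegrableOn (fun t : ℝ => Real.exp (-(t * r)) * (t ^ 5 / 720 - t ^ 11 / 479001600))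
      (Ioi 0) := by
  have h5 : Integrable (fun t : ℝ => Real.exp (-(t * r)) * t ^ 5) (volume.restrict (Ioi 0)) :=
    integrableOn_exp_neg_mul_mul_pow 5 hr
  have h11 : Integrable (fun t : ℝ => Real.exp (-(t * r)) * t ^ 11) (volume.restrict (Ioi 0)) :=
    integrableOn_exp_neg_mul_mul_pow 11 hr
  have h := (h5.div_const 720).sub (h11.div_const 479001600)
  refine IntegrableOn.congr_fun h (fun t _ => ?_) measurableSet_Ioi
  simp only [Pi.sub_apply]
  ring

/-- **Laplace representation of the Lennard-Jones potential**: for `r > 0`,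
`∫_0^∞ e^{-tr} (t⁵/720 - t¹¹/479001600) dt = r⁻⁶/6 - r⁻¹²/12 = -lennardJones r`. -/
private theorem psiPos_integral_laplace {r : ℝ} (hr : 0 < r) :
    ∫ t in Ioi (0 : ℝ), Real.exp (-(t * r)) * (t ^ 5 / 720 - t ^ 11 / 479001600)
      = -lennardJones r := by
  have h5 : Integrable (fun t : ℝ => Real.exp (-(t * r)) * t ^ 5) (volume.restrict (Ioi 0)) :=
    integrableOn_exp_neg_mul_mul_pow 5 hr
  have h11 : Integrable (fun t : ℝ => Real.exp (-(t * r)) * t ^ 11) (volume.restrict (Ioi 0)) :=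
    integrableOn_exp_neg_mul_mul_pow 11 hr
  have e : ∀ t : ℝ, Real.exp (-(t * r)) * (t ^ 5 / 720 - t ^ 11 / 479001600)
      = Real.exp (-(t * r)) * t ^ 5 / 720 - Real.exp (-(t * r)) * t ^ 11 / 479001600 :=
    fun t => by ring
  simp_rw [e]
  rw [integral_sub (h5.div_const 720) (h11.div_const 479001600), integral_div, integral_div,
    integral_exp_neg_mul_mul_pow 5 hr, integral_exp_neg_mul_mul_pow 11 hr]
  unfold lennardJones
  have hr0 : r ≠ 0 := hr.ne'
  simp only [Nat.factorial, Nat.succ_eq_add_one, Nat.cast_mul, Nat.cast_one]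
  field_simp
  ring

/-- Decay bound: for `n ≥ 3`, `a > 0`, `c ≥ 0`, the family `k ↦ (k+1) · (c + (k+1)a)⁻ⁿ` is summable
(comparison with `a⁻ⁿ (k+1)^{-(n-1)}`). -/
private theorem psiPos_summable_weighted_inv_pow (n : ℕ) (hn : 3 ≤ n) {a : ℝ} (ha : 0 < a) {c : ℝ}
    (hc : 0 ≤ c) :
    Summable (fun k : ℕ => ((k : ℝ) + 1) * ((c + ((k : ℝ) + 1) * a)⁻¹) ^ n) := by
  have hs : Summable (fun k : ℕ => (((k : ℝ) + 1) ^ (n - 1))⁻¹ * (a⁻¹) ^ n) := by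
    have h := (Real.summable_nat_pow_inv.2 (by omega : 1 < n - 1))
    have h' := (summable_nat_add_iff 1).2 h
    refine (h'.mul_right ((a⁻¹) ^ n)).congr fun k => ?_
    push_cast
    rfl
  refine hs.of_nonneg_of_le (fun k => ?_) (fun k => ?_)
  · positivity
  · have hk : (0 : ℝ) < (k : ℝ) + 1 := by positivity
    have hka : 0 < ((k : ℝ) + 1) * a := mul_pos hk ha
    have h1 : (c + ((k : ℝ) + 1) * a)⁻¹ ≤ (((k : ℝ) + 1) * a)⁻¹ := inv_anti₀ hka (by linarith)
    have h2 : ((c + ((k : ℝ) + 1) * a)⁻¹) ^ n ≤ ((((k : ℝ) + 1) * a)⁻¹) ^ n :=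
      pow_le_pow_left₀ (inv_nonneg.2 (by positivity)) h1 n
    calc ((k : ℝ) + 1) * ((c + ((k : ℝ) + 1) * a)⁻¹) ^ n
        ≤ ((k : ℝ) + 1) * ((((k : ℝ) + 1) * a)⁻¹) ^ n := mul_le_mul_of_nonneg_left h2 hk.le
      _ = (((k : ℝ) + 1) ^ (n - 1))⁻¹ * (a⁻¹) ^ n := by
        obtain ⟨m, rfl⟩ : ∃ m, n = m + 1 := ⟨n - 1, by omega⟩
        rw [Nat.add_sub_cancel, mul_inv, mul_pow, pow_succ, inv_pow, inv_pow]
        field_simp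

/-- Summability of the weighted Lennard-Jones tail `k ↦ (k+1) · V(c + (k+1)a)` for `a > 0`,
`c ≥ 0`. -/
private theorem psiPos_summable_weighted_lennardJones {a : ℝ} (ha : 0 < a) {c : ℝ} (hc : 0 ≤ c) :
    Summable (fun k : ℕ => ((k : ℝ) + 1) * lennardJones (c + ((k : ℝ) + 1) * a)) := by
  have h12 := psiPos_summable_weighted_inv_pow 12 (by norm_num) ha hc
  have h6 := psiPos_summable_weighted_inv_pow 6 (by norm_num) ha hc
  refine ((h12.mul_left (1 / 12)).sub (h6.mul_left (1 / 6))).congr fun k => ?_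
  unfold lennardJones
  ring

/-- The Gram form through the Laplace representation: for `b > 0`, the integrand
`e^{-tb} p(t) · (t · (Q(t)/t))`, `Q(t) = Σ_{ij} w_i w_j e^{-t|x_i - x_j|}`, is integrable on `(0,∞)`
and integrates to `-Σ_{ij} w_i w_j V(|x_i - x_j| + b)`. -/
private theorem psiPos_integral_gram {n : ℕ} (x w : Fin n → ℝ) {b : ℝ} (hb : 0 < b) :
    IntegrableOn (fun t : ℝ => Real.exp (-(t * b)) * (t ^ 5 / 720 - t ^ 11 / 479001600)
      * (t * ((∑ i, ∑ j, w i * w j * Real.exp (-(t * |x i - x j|))) / t))) (Set.Ioi 0) ∧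
    ∫ t in Set.Ioi (0 : ℝ), Real.exp (-(t * b)) * (t ^ 5 / 720 - t ^ 11 / 479001600)
      * (t * ((∑ i, ∑ j, w i * w j * Real.exp (-(t * |x i - x j|))) / t))
      = -∑ i, ∑ j, w i * w j * lennardJones (|x i - x j| + b) := by
  -- on `(0,∞)` the integrand is the finite sum `G`
  set G : ℝ → ℝ := fun t => ∑ i, ∑ j, w i * w j *
    (Real.exp (-(t * (|x i - x j| + b))) * (t ^ 5 / 720 - t ^ 11 / 479001600)) with hG
  have heq : EqOn G (fun t : ℝ => Real.exp (-(t * b)) * (t ^ 5 / 720 - t ^ 11 / 479001600)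
      * (t * ((∑ i, ∑ j, w i * w j * Real.exp (-(t * |x i - x j|))) / t))) (Ioi 0) := by
    intro t ht
    have ht0 : t ≠ 0 := (mem_Ioi.1 ht).ne'
    simp only [hG]
    rw [mul_div_cancel₀ _ ht0, Finset.mul_sum]
    refine Finset.sum_congr rfl fun i _ => ?_
    rw [Finset.mul_sum]
    refine Finset.sum_congr rfl fun j _ => ?_
    rw [show -(t * (|x i - x j| + b)) = -(t * |x i - x j|) + -(t * b) by ring, Real.exp_add]
    ring
  have hint : ∀ i j : Fin n, Integrable (fun t : ℝ => w i * w j *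
      (Real.exp (-(t * (|x i - x j| + b))) * (t ^ 5 / 720 - t ^ 11 / 479001600)))
      (volume.restrict (Ioi 0)) := fun i j =>
    (psiPos_integrableOn_laplace (by positivity : 0 < |x i - x j| + b)).const_mul _
  have hGint : IntegrableOn G (Ioi 0) :=
    integrable_finsetSum _ fun i _ => integrable_finsetSum _ fun j _ => hint i j
  refine ⟨hGint.congr_fun heq measurableSet_Ioi, ?_⟩
  rw [← setIntegral_congr_fun measurableSet_Ioi heq]
  simp only [hG]
  rw [integral_finsetSum _ fun i _ => integrable_finsetSum _ fun j _ => hint i j,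
    ← Finset.sum_neg_distrib]
  refine Finset.sum_congr rfl fun i _ => ?_
  rw [integral_finsetSum _ fun j _ => hint i j, ← Finset.sum_neg_distrib]
  refine Finset.sum_congr rfl fun j _ => ?_
  rw [integral_const_mul, psiPos_integral_laplace (by positivity : 0 < |x i - x j| + b)]
  ring

/-- **`Ψ_a` is of positive type.**  Given (i) antitonicity of `t ↦ Q(t)/t` on `(0,∞)` for every
exponential Gram form `Q` (the statement of `stub_quadAntitone`) and (ii) the single-crossing lemma
(the statement of `stub_crossing`), for every `a > 0` at zero pressure the kernel
`Ψ_a(y) = -4 Σ_k (k+1) V(|y| + (k+1)a)` satisfies `0 ≤ Σ_{ij} w_i w_j Ψ_a(x_i - x_j)`. -/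
theorem stub_psiPosTypeOf :
    (∀ (n : ℕ) (x : Fin n → ℝ) (w : Fin n → ℝ),
      AntitoneOn (fun t : ℝ => (∑ i, ∑ j, w i * w j * Real.exp (-(t * |x i - x j|))) / t) (Set.Ioi 0)) →
    (∀ a : ℝ, 0 < a →
      HasSum (fun k : ℕ => ((k : ℝ) + 1) * ((((k : ℝ) + 1) * a)⁻¹ ^ 7 - (((k : ℝ) + 1) * a)⁻¹ ^ 13)) 0 →
      ∀ h : ℝ → ℝ, AntitoneOn h (Set.Ioi 0) →
      (∀ k : ℕ, MeasureTheory.IntegrableOn (fun t : ℝ => Real.exp (-(t * (((k : ℝ) + 1) * a)))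
        * (t ^ 5 / 720 - t ^ 11 / 479001600) * (t * h t)) (Set.Ioi 0)) →
      Summable (fun k : ℕ => ((k : ℝ) + 1) * ∫ t in Set.Ioi (0 : ℝ), Real.exp (-(t * (((k : ℝ) + 1) * a)))
        * (t ^ 5 / 720 - t ^ 11 / 479001600) * (t * h t)) →
      0 ≤ ∑' k : ℕ, ((k : ℝ) + 1) * ∫ t in Set.Ioi (0 : ℝ), Real.exp (-(t * (((k : ℝ) + 1) * a)))
        * (t ^ 5 / 720 - t ^ 11 / 479001600) * (t * h t)) →
    ∀ a : ℝ, 0 < a →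
    HasSum (fun k : ℕ => ((k : ℝ) + 1) * ((((k : ℝ) + 1) * a)⁻¹ ^ 7 - (((k : ℝ) + 1) * a)⁻¹ ^ 13)) 0 →
    ∀ (n : ℕ) (x : Fin n → ℝ) (w : Fin n → ℝ),
      0 ≤ ∑ i, ∑ j, w i * w j * (-4 * ∑' k : ℕ, ((k : ℝ) + 1) * lennardJones (|x i - x j| + ((k : ℝ) + 1) * a)) := by
  intro hQA hCR a ha hz n x w
  -- the pair families are summable, and `b_k = (k+1) a > 0`
  have hsum : ∀ i j : Fin n, Summable (fun k : ℕ =>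
      ((k : ℝ) + 1) * lennardJones (|x i - x j| + ((k : ℝ) + 1) * a)) :=
    fun i j => psiPos_summable_weighted_lennardJones ha (abs_nonneg _)
  have hb : ∀ k : ℕ, (0 : ℝ) < ((k : ℝ) + 1) * a := fun k => by positivity
  have hG := fun k : ℕ => psiPos_integral_gram x w (hb k)
  -- each term of the crossing sum is a finite combination of the pair families
  have e : ∀ k : ℕ, ((k : ℝ) + 1) * ∫ t in Set.Ioi (0 : ℝ), Real.exp (-(t * (((k : ℝ) + 1) * a)))
      * (t ^ 5 / 720 - t ^ 11 / 479001600)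
      * (t * ((∑ i, ∑ j, w i * w j * Real.exp (-(t * |x i - x j|))) / t))
      = ∑ i, ∑ j, -(w i * w j) * (((k : ℝ) + 1) * lennardJones (|x i - x j| + ((k : ℝ) + 1) * a)) := by
    intro k
    rw [(hG k).2, mul_neg, Finset.mul_sum, ← Finset.sum_neg_distrib]
    refine Finset.sum_congr rfl fun i _ => ?_
    rw [Finset.mul_sum, ← Finset.sum_neg_distrib]
    refine Finset.sum_congr rfl fun j _ => ?_
    ring
  have hS : Summable (fun k : ℕ => ∑ i, ∑ j,
      -(w i * w j) * (((k : ℝ) + 1) * lennardJones (|x i - x j| + ((k : ℝ) + 1) * a))) :=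
    summable_sum fun i _ => summable_sum fun j _ => (hsum i j).mul_left _
  -- the crossing lemma with `h = Q / t`
  have key := hCR a ha hz (fun t => (∑ i, ∑ j, w i * w j * Real.exp (-(t * |x i - x j|))) / t)
    (hQA n x w) (fun k => (hG k).1) (hS.congr fun k => (e k).symm)
  rw [tsum_congr e, Summable.tsum_finsetSum
    (fun i _ => summable_sum fun j _ => (hsum i j).mul_left _)] at key
  have ht : ∑ i, ∑' k : ℕ, ∑ j, -(w i * w j) * (((k : ℝ) + 1)
      * lennardJones (|x i - x j| + ((k : ℝ) + 1) * a))
      = ∑ i, ∑ j, -(w i * w j) * ∑' k : ℕ, ((k : ℝ) + 1)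
        * lennardJones (|x i - x j| + ((k : ℝ) + 1) * a) := by
    refine Finset.sum_congr rfl fun i _ => ?_
    rw [Summable.tsum_finsetSum (fun j _ => (hsum i j).mul_left _)]
    refine Finset.sum_congr rfl fun j _ => ?_
    exact tsum_mul_left
  rw [ht] at key
  have hgoal : ∑ i, ∑ j, w i * w j * (-4 * ∑' k : ℕ, ((k : ℝ) + 1)
      * lennardJones (|x i - x j| + ((k : ℝ) + 1) * a))
      = 4 * ∑ i, ∑ j, -(w i * w j) * ∑' k : ℕ, ((k : ℝ) + 1)
        * lennardJones (|x i - x j| + ((k : ℝ) + 1) * a) := by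
    rw [Finset.mul_sum]
    refine Finset.sum_congr rfl fun i _ => ?_
    rw [Finset.mul_sum]
    refine Finset.sum_congr rfl fun j _ => ?_
    ring
  rw [hgoal]
  exact mul_nonneg (by norm_num) key

end Summit.AtomisticToContinuum.Crystallization.Theorems.ThreeConeCertificateExactCertificate.Transfer1D

end
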